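import Summits.CriticalPhenomena.PercolationContinuityZ3.Theorems.Transplant.SkelNegBParamsLO
import HarnessLib

/-!
# N1 params, chain of record `NegB`, part B: THE BRIDGE PAIR `(M_b, n_b)` OF THE (R) COLUMN (p3-g9 ruling 2026-08-21T15:38:39Z, NEG-SCOPE B.13 = stmt-g13's option (b″) with
# its OWN zone index) — `NegB.MB D mb := max M_u mb` (slot `mb`: `:= 2Δ₀ + 26 ⊔ 22·M_u + 58` at the end, p3-g9 15:55:22Z / p5-g8 15:52:09Z), `NegB.nB D mb b := NegPrm.nS (n₁ M_b) M_b b ρz` (slot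
# `b := Δ₀ := D.k + 2R′ + 1`, the EXACT (R-F2) floor of p3-g9 15:55:22Z, read AFTER the kit block, so `b ≤ n_b` BY DEFINITION — (R-F2) made satisfiable by the order of constants), the bridge data, the oriented
# bit/map `oB/φB`, the clause from `FactsO`, and the pair's admissibility (for the pair slot `Pv` of the choice function)

builds on p205010 (kernel theorem, internal audit signed; external expert review pending) — nothing in this file uses p205010; NOTHING is claimed about
the node `SamePDropOfSkeletonNeg₁` (OPEN).
Status sentence (coordinator 2026-08-20T04:30Z): "θ(p_c) = 0 on ℤ^d, all d ≥ 2 — kernel-verified (Lean 4/Mathlib, standard axioms); internal adversarial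
audit SIGNED 2026-08-20 04:29Z; external expert review pending."
Lane `prim-bschramm-*`, seat `prim-bschramm-stmt` (gen 13); helper file (`--supports stmt-CriticalPhenomena-4575 --as helper`); ledger HOME/prim-bschramm-stmt/NEG-PARAMS.md v0.10;
HOME/prim-bschramm-stmt-g13/FEASIBILITY.md (why `n_s` cannot carry (R-F2): `R′ = T₀ + Lcnt + 1 > 3·As ≥ 3·n_s`).
ORDER OF CONSTANTS (acyclic, no LEVEL-0 change): `M_u → n_s → short data → kit block (Rlev, R′) → (M_b, n_b) → bridge data (h_b, ℓ_b, v_b) → M_L (box slot g ∋ 16(n_b+ℓ_b+|h_b|)) → n_L`.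
* §1 `MB`, `nB`, `hB/ℓB/vB`, `MB_facts` (`M_u ≤ M_b`, `mb ≤ M_b`, `D.M₀ ≤ M_b`), `MB_floors`, `nB_facts` (`n₁ M_b ≤ n_b`, `M_b < n_b`, `b ≤ n_b`, `M_b + b + 2 + ρz ≤ n_b`), **`bridge_adm`**
  (`D.M₀ ≤ M_b ∧ D.n₁ M_b ≤ n_b` — the pair-slot admissibility), `RF2_at`;
* §2 `oB/φB`, `lip_φB/steps_φB`, **`clauseB_of_factsO`** (`O.merged.EqGeom G φB t M_b n_b ∧ |h_b| ≤ 10·n_b`), `eqNumB_of_eqGeom`, `ℓB_ge` (`mb + 1 ≤ ℓ_b`: the one-stride room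
  `ℓ_b ≥ 2Δ₀ + 27` once `mb ≥ 2Δ₀ + 26`, p5-g8 15:52:09Z needs `≥ 2Δ₀ + 24`), `MB_floors`.
[cite: KozmaNitzan2024, §4 Theorem 6 (pp. 25–31): the order of constants] [cite: MartineauTassion2017, §3.2 Lemma 3.5]
-/

noncomputable section

open scoped Classical

namespace Summit.CriticalPhenomena.PercolationContinuityZ3.Theorems.Transplant

namespace PlanarSkeletonNeg

namespace NegB

open Literature.Probability.Percolation Literature.Probability.LatticeModels SimpleGraph
open SkelConc (Consts)
open Skelφ (oriφ trφ)
open Skelφ.StepI (DataN)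
open Neg

section Bridge

variable {V : Type} [DecidableEq V] [Countable V] {G : SimpleGraph V} [G.LocallyFinite] (Φ : PlanarSkeletonNeg G) (t : V)
  (D DT : DataN V) (ori : V → ℕ → ℕ → Bool) (mb b : ℕ)

/-! ## §1 The bridge zone index, width and data -/

/-- **The bridge zone index with floor slot `mb`**: `M_b := max M_u mb`. [this work] -/
def MB (D : DataN V) (mb : ℕ) : ℕ := max (Mu D) mb

/-- **The bridge width with clearance slot `b`**: `n_b := max (n₁ M_b) (M_b + b + 2 + ρz)` (the landed `NegPrm.nS` at the bridge index with its `R′`-slot at `b`). [this work] -/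
def nB (D : DataN V) (mb b : ℕ) : ℕ := Skelφ.NegPrm.nS (D.n₁ (MB D mb)) (MB D mb) b (ρz D)

/-- The bridge shear `h_b := D.hgt t M_b n_b`. [this work] -/
def hB (t : V) (D : DataN V) (mb b : ℕ) : ℤ := D.hgt t (MB D mb) (nB D mb b)

/-- The bridge half-length `ℓ_b := D.len t M_b n_b`. [this work] -/
def ℓB (t : V) (D : DataN V) (mb b : ℕ) : ℕ := D.len t (MB D mb) (nB D mb b)

/-- The bridge split point `v_b := D.spl t M_b n_b`. [this work] -/
def vB (t : V) (D : DataN V) (mb b : ℕ) : ℤ := D.spl t (MB D mb) (nB D mb b)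

omit [DecidableEq V] [Countable V] [G.LocallyFinite] in
/-- `M_u ≤ M_b`, `mb ≤ M_b`, `D.M₀ ≤ M_b`. [folklore] -/
theorem MB_facts : Mu D ≤ MB D mb ∧ mb ≤ MB D mb ∧ D.M₀ ≤ MB D mb :=
  ⟨le_max_left _ _, le_max_right _ _, (M₀_le_Mu D).trans (le_max_left _ _)⟩

omit [DecidableEq V] [Countable V] [G.LocallyFinite] in
/-- **The bridge width's facts**: `n₁ M_b ≤ n_b`, `M_b < n_b`, `b ≤ n_b`, `M_b + b + 2 + ρz ≤ n_b` — for EVERY `b`, in particular `b := Δ₀` read after the kit block. [folklore] -/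
theorem nB_facts : D.n₁ (MB D mb) ≤ nB D mb b ∧ MB D mb < nB D mb b ∧ b ≤ nB D mb b ∧ MB D mb + b + 2 + ρz D ≤ nB D mb b :=
  ⟨Skelφ.NegPrm.n₁_le_nS _ _ _ _, Skelφ.NegPrm.Mu_lt_nS _ _ _ _, (Skelφ.NegPrm.R'_le_nS _ _ _ _).1, Skelφ.NegPrm.floor_le_nS _ _ _ _⟩

omit [DecidableEq V] [Countable V] [G.LocallyFinite] in
/-- **The bridge pair is admissible** (`D.M₀ ≤ M_b`, `D.n₁ M_b ≤ n_b`) — the certificate the pair slot `Pv` carries. [folklore] -/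
theorem bridge_adm : D.M₀ ≤ (MB D mb, nB D mb b).1 ∧ D.n₁ (MB D mb, nB D mb b).1 ≤ (MB D mb, nB D mb b).2 :=
  ⟨(MB_facts D mb).2.2, (nB_facts D mb b).1⟩

/-- **(R-F2) at the ledger's names** (exact floor, p3-g9 2026-08-21T15:55:22Z): with `b := Δ₀ := D.k + 2R′ + 1`, `Δ₀ ≤ n_b`. [folklore] -/
theorem RF2_at (κ : Consts) (p : unitInterval) : D.k + 2 * R' κ Φ t p D + 1 ≤ nB D mb (D.k + 2 * R' κ Φ t p D + 1) :=
  (nB_facts D mb _).2.2.1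

/-- **The one-stride floor through `mb`**: with `mb := max (2Δ₀ + 26) (22·M_u + 58)`, `2Δ₀ + 26 ≤ M_b` and `22·M_u + 58 ≤ M_b`. [folklore] -/
theorem MB_floors (κ : Consts) (p : unitInterval) :
    2 * (D.k + 2 * R' κ Φ t p D + 1) + 26 ≤ MB D (max (2 * (D.k + 2 * R' κ Φ t p D + 1) + 26) (22 * Mu D + 58)) ∧
      22 * Mu D + 58 ≤ MB D (max (2 * (D.k + 2 * R' κ Φ t p D + 1) + 26) (22 * Mu D + 58)) :=
  ⟨(le_max_left _ _).trans (MB_facts D _).2.1, (le_max_right _ _).trans (MB_facts D _).2.1⟩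

/-! ## §2 The oriented bridge bit and map, the clause from `FactsO` -/

/-- **The bridge pair's orientation bit** `o_b := ori t M_b n_b` (values at the merged record). [this work] -/
def oB : Bool := ori t (MB (D.orient DT ori) mb) (nB (D.orient DT ori) mb b)

/-- **The planar map the BRIDGE STEP reads**: `Φ.φ` or its transpose. [this work] -/
def φB : V → Site 2 := oriφ Φ.φ (oB t D DT ori mb b)

omit [DecidableEq V] [Countable V] in
/-- `φB` is 1-Lipschitz. [folklore] -/
theorem lip_φB : Skelφ.Lip G (φB Φ t D DT ori mb b) := Skelφ.lip_oriφ Φ.lip _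

omit [DecidableEq V] [Countable V] in
/-- `φB` has unit steps. [folklore] -/
theorem steps_φB : Skelφ.Steps G (φB Φ t D DT ori mb b) := Skelφ.steps_oriφ Φ.step _

omit [DecidableEq V] [Countable V] in
/-- **THE BRIDGE CLAUSE FROM `FactsO`**: the merged record's geometric clause at `(M_b, n_b)` FOR THE ORIENTED MAP `φB`, and `|h_b| ≤ 10·n_b`. [this work] -/
theorem clauseB_of_factsO (hR : DT.R = D.R)
    (hfacts : ∀ M, D.M₀ ≤ M → ∀ n, D.n₁ M ≤ n →
      (ori t M n = true → D.EqGeom G Φ.φ t M n ∧ (D.hgt t M n).natAbs ≤ 10 * n) ∧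
      (ori t M n = false → DT.EqGeom G (trφ Φ.φ) t M n ∧ (DT.hgt t M n).natAbs ≤ 10 * n)) :
    (D.orient DT ori).EqGeom G (φB Φ t D DT ori mb b) t (MB (D.orient DT ori) mb) (nB (D.orient DT ori) mb b) ∧
      (hB t (D.orient DT ori) mb b).natAbs ≤ 10 * nB (D.orient DT ori) mb b :=
  Skelφ.StepI.orient_clause_all hR hfacts _ (MB_facts _ mb).2.2 _ (nB_facts _ mb b).1

omit [DecidableEq V] [Countable V] in
/-- **The bridge pair's geometric facts unpacked** (ℤ shapes), for ANY map. [folklore] -/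
theorem eqNumB_of_eqGeom (ψ : V → Site 2) (hE : D.EqGeom G ψ t (MB D mb) (nB D mb b)) :
    MB D mb < nB D mb b ∧ MB D mb < ℓB t D mb b ∧ |vB t D mb b| ≤ (nB D mb b : ℤ) ∧
      ((MB D mb : ℤ) + 1) * ((nB D mb b : ℤ) + |hB t D mb b|) ≤ (nB D mb b : ℤ) * ((ℓB t D mb b : ℤ) + 1) :=
  eqGeom_num_of t D ψ hE

omit [DecidableEq V] [Countable V] in
/-- **The one-stride room**: `mb + 1 ≤ ℓ_b` (from `M_b < ℓ_b`; with `mb ≥ 2Δ₀ + 26` this is `ℓ_b ≥ 2Δ₀ + 27 ≥ 2Δ₀ + 25`, p3-g9 15:55:22Z / p5-g8 15:52:09Z). [folklore] -/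
theorem ℓB_ge (ψ : V → Site 2) (hE : D.EqGeom G ψ t (MB D mb) (nB D mb b)) : mb + 1 ≤ ℓB t D mb b :=
  (Nat.succ_le_of_lt (lt_of_le_of_lt (MB_facts D mb).2.1 (eqNumB_of_eqGeom t D mb b ψ hE).2.1))

end Bridge

end NegB

end PlanarSkeletonNeg

end Summit.CriticalPhenomena.PercolationContinuityZ3.Theorems.Transplant

end
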